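import Summits.NavierStokesRegularity.NavierStokesRegularity.Theorems.SqueezeCycleExtremalBiaxialitySubcriticalIffRecurrentLiouville
import Summits.NavierStokesRegularity.NavierStokesRegularity.Theorems.SqueezeCycleExtremalBiaxialitySubcriticalReductions
import Summits.NavierStokesRegularity.NavierStokesRegularity.Theorems.AdaptedFrequencyAdaptedFrequencyConvergesStubRecurrentPinchedBridgeGradLedger
import Summits.NavierStokesRegularity.NavierStokesRegularity.Theorems.SqueezeCycleSingularProfileOfNontrivial
import Summits.NavierStokesRegularity.NavierStokesRegularity.Theorems.IsobarTomographyTubeAlternativeCalibration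
import Summits.NavierStokesRegularity.NavierStokesRegularity.Theses.ClockStretchingLaw
import Summits.NavierStokesRegularity.NavierStokesRegularity.Theses.ExtremalTypeIConstant
import Summits.NavierStokesRegularity.NavierStokesRegularity.Theses.DulacContraction
import Literature.Analysis.FluidPDE.TypeIRateOseenMildRepresentative
import Literature.Analysis.FluidPDE.LocalTypeICongr
import HarnessLib

/-!
# Route `SqueezeCycle`, crux `ExtremalBiaxialitySubcritical` (stmt-NavierStokesRegularity-11609):
# the scaled-energy clauses of the class `𝒦_C` are REDUNDANT — the crux is equivalent, by name,
# to `TypeIAncientLiouville` (stmt-4050)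

Theorems-only `--supports` helper (line lead c2, 2026-08-17), companion of
`SqueezeCycleExtremalBiaxialitySubcriticalIffRecurrentLiouville.lean`.

The route target `SqueezeLiouville` is Type-I Liouville on the class `𝒦_C` = {smooth KNSS-mild ancient
fields with the rate `‖u‖ ≤ C/√(−t)` AND the two scale-invariant local energy bounds `A, E ≤ C`}; the
target `TypeIAncientLiouville` of routes SymmetryModuliCount / ExtremalTypeIConstant is Type-I Liouville
on the larger rate class `A_C` (no energy clauses).  Both energy clauses are CONSEQUENCES of the rate:
the `A`-clause is the proved crux `FarPastLedger` (stmt-14060, `FarPastLedger_proof`) and the `E`-clause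
is the far-past gradient ledger `farPast_gradLedger` (local energy identity with the dissipation kept,
landed for route AdaptedFrequency).  Hence:

* `squeezeClass_of_isTypeIAncientMild` : `A_C ⊆ 𝒦_{C'}` with `C' = C'(C)` — every Type-I ancient mild
  field in the Oseen gauge satisfies the route's inline class with a larger constant;
* `typeIAncientLiouville_of_squeezeLiouville` : `SqueezeLiouville → TypeIAncientLiouville`, and with the
  landed converse `squeezeLiouville_of_typeIAncientLiouville` the equivalences
  `squeezeLiouville_iff_typeIAncientLiouville`, `extremalBiaxialitySubcritical_iff_typeIAncientLiouville`,
  `typeIAncientLiouville_iff_recurrentLiouville`, `typeIAncientLiouville_iff_noTypeIRateProfile`,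
  `typeIAncientLiouville_iff_rellichScar`.

* `squeezeLiouville_of_noSingularTypeIModel` : ClockStretchingLaw's target `NoSingularTypeIModel`
  (stmt-10569: no member of `𝒦_C` is pointwise unbounded at the space–time origin) implies the route
  target — a nontrivial member has a Type-I-rate singular profile (item 15368,
  `squeezeCycle_singularProfileOfNontrivial_proof`), whose continuous Oseen-mild representative
  (`exists_oseenMild_repr_of_typeIBound_lt_top`, `isTypeIAncientMild_of_continuous_oseenMild`) is a member
  of `𝒦_{C'}` (`squeezeClass_of_isTypeIAncientMild`), still backward-singular at the origin
  (`IsBackwardSingularPoint.congr_ae`), hence pointwise unbounded there; with the landed converse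
  `TubeAlternative.noSingularTypeIModel_of_squeezeLiouville`: `squeezeLiouville_iff_noSingularTypeIModel`,
  `extremalBiaxialitySubcritical_iff_noSingularTypeIModel`;
* by-name copies for the other routes' spellings: `extremalBiaxialitySubcritical_iff_extremalTypeIConstant_typeIAncientLiouville`,
  `extremalBiaxialitySubcritical_iff_dulacContraction_noTypeIRateProfile`, and for this route's own children
  `extremalBiaxialitySubcritical_iff_noApexTypeIProfile_and_apexLocalisation` (SqueezeCycle spellings of 11716 ∧ 11719).

For the planners: items 11609, 11608 (SqueezeCycle), 4050 (SymmetryModuliCount / ExtremalTypeIConstant),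
1589, 1588 (RecurrentProfiles / DulacContraction), 10569 (ClockStretchingLaw) and the pair 11716 ∧ 11719
(RellichScar) are ONE node: the targets of six routes and this crux are pairwise equivalent by
kernel-checked theorems.

## References

* G. Koch, N. Nadirashvili, G. Seregin, V. Šverák, Acta Math. 203 (2009) = arXiv:0709.3599, §1, §6.
  [KochNadirashviliSereginSverak2009]
* D. Albritton, T. Barker, J. Math. Fluid Mech. 21 (2019) = arXiv:1811.00502, Thm. 1.1, §1, Rem. 3.2.
  [AlbrittonBarker2019]
-/

noncomputable section

-- the sub-problem namespace repeats the summit name (D-0017 layout `Summit.<S>.<P>.Theorems`)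
set_option linter.dupNamespace false

namespace Summit.NavierStokesRegularity.NavierStokesRegularity.Theorems

open MeasureTheory Set Function Filter Metric
open Literature.Analysis Literature.Analysis.FluidPDE
open Summit.NavierStokesRegularity.NavierStokesRegularity.Theses
open Summit.NavierStokesRegularity.NavierStokesRegularity.Theorems.AdaptedFrequencyConverges.BirkhoffRecurrentHull
  (farPast_gradLedger)

/-- **The scaled-energy clauses of `𝒦_C` are redundant: `A_C ⊆ 𝒦_{C'(C)}`.**  For every `C` there is
`C'` such that every Type-I ancient mild field in the Oseen gauge with rate constant `C`
(`IsTypeIAncientMild C u`) satisfies the inline class of the route target `SqueezeLiouville` with the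
constant `C'`: joint smoothness, `div u = 0`, the written-out KNSS-mild identity, the rate `C' ≥ C`, the
scaled energy `r⁻¹ ∫_{B_r(x₀)} ‖u(t)‖² ≤ C'` for `t₀ − r² < t < t₀ ≤ 0` (far-past ledger, item 14060) and
the scaled enstrophy `r⁻¹ ∫_{t₀−r²}^{t₀} ∫_{B_r(x₀)} ‖∇u‖² ≤ C'` (far-past gradient ledger).
[cite: KochNadirashviliSereginSverak2009, §1 and §6] [cite: AlbrittonBarker2019, §1, Rem. 3.2] -/
theorem squeezeClass_of_isTypeIAncientMild (C : ℝ) : ∃ C' : ℝ, C ≤ C' ∧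
    ∀ u : ℝ → EuclideanSpace ℝ (Fin 3) → EuclideanSpace ℝ (Fin 3), IsTypeIAncientMild C u →
      ContDiffOn ℝ (⊤ : ℕ∞) (Function.uncurry u) (Set.Iio 0 ×ˢ Set.univ) ∧
      (∀ t < 0, Literature.Analysis.FluidPDE.VectorCalculus.IsDivFree (u t)) ∧
      (∀ s t : ℝ, s < t → t < 0 → ∀ x, u t x =
        Literature.Analysis.FluidPDE.heatFlow (u s) (t-s) x - ∫ τ in Set.Ioo s t, ∫ y,
          ((-(inner ℝ (x-y) (u τ y) / (2*(t-τ)) *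
            Literature.Analysis.UnboundedOperators.heatKernel (t-τ) (x-y))) • u τ y +
          (∫ σ in Set.Ioi (t-τ), Literature.Analysis.UnboundedOperators.heatKernel σ (x-y) / (4*σ^2)) •
            (inner ℝ (x-y) (u τ y) • u τ y + inner ℝ (u τ y) (u τ y) • (x-y) +
              inner ℝ (x-y) (u τ y) • u τ y) -
          ((∫ σ in Set.Ioi (t-τ), Literature.Analysis.UnboundedOperators.heatKernel σ (x-y) / (8*σ^3)) *
            (inner ℝ (x-y) (u τ y) * inner ℝ (x-y) (u τ y))) • (x-y))) ∧
      Literature.Analysis.FluidPDE.HasTypeITimeDecay C' u ∧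
      (∀ (x₀ : EuclideanSpace ℝ (Fin 3)) (t₀ r : ℝ), t₀ ≤ 0 → 0 < r →
        (∀ t, t₀ - r^2 < t → t < t₀ → r⁻¹ * ∫ x in Metric.ball x₀ r, ‖u t x‖^2 ≤ C') ∧
        r⁻¹ * ∫ t in Set.Ioo (t₀ - r^2) t₀, ∫ x in Metric.ball x₀ r, ‖fderiv ℝ (u t) x‖^2 ≤ C') := by
  obtain ⟨K, hK⟩ := FarPastLedger_proof C
  obtain ⟨KE, -, hE⟩ := farPast_gradLedger C
  refine ⟨max C (max K KE), le_max_left _ _, fun u hu => ?_⟩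
  have hKC' : K ≤ max C (max K KE) := (le_max_left _ _).trans (le_max_right _ _)
  have hEC' : KE ≤ max C (max K KE) := (le_max_right _ _).trans (le_max_right _ _)
  obtain ⟨h1, h2, h3, h4⟩ := isTypeIAncientMild_iff.1 hu
  refine ⟨h1, h2, fun s t hst ht x => ?_, fun t ht x => ?_, fun x₀ t₀ r ht₀ hr => ⟨?_, ?_⟩⟩
  · rw [h3 s t hst ht x]
    rfl
  · exact (h4 t ht x).trans (div_le_div_of_nonneg_right (le_max_left _ _) (Real.sqrt_nonneg _))
  · intro t ht1 ht2
    have ht : t < 0 := lt_of_lt_of_le ht2 ht₀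
    have hA := hK u hu t ht x₀ r hr
    calc r⁻¹ * ∫ x in ball x₀ r, ‖u t x‖ ^ 2 ≤ r⁻¹ * (K * r) :=
          mul_le_mul_of_nonneg_left hA (inv_nonneg.2 hr.le)
      _ = K := by field_simp
      _ ≤ max C (max K KE) := hKC'
  · exact (hE u hu x₀ t₀ r ht₀ hr).trans hEC'

/-- **The route target implies `TypeIAncientLiouville`** (stmt-4050): a member of the rate class `A_C`
lies in `𝒦_{C'(C)}` (`squeezeClass_of_isTypeIAncientMild`), which the target annihilates on `t < 0`.
[cite: KochNadirashviliSereginSverak2009, §1 and §6] -/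
theorem typeIAncientLiouville_of_squeezeLiouville (hX : SqueezeCycle.SqueezeLiouville) :
    SymmetryModuliCount.TypeIAncientLiouville := by
  intro C u hu
  have hu' : IsTypeIAncientMild C u := isTypeIAncientMild_iff.2 hu
  obtain ⟨C', -, hC'⟩ := squeezeClass_of_isTypeIAncientMild C
  exact hX C' u (hC' u hu')

/-- **Target ↔ SymmetryModuliCount's target**: `SqueezeLiouville ↔ TypeIAncientLiouville` (items
11608 ↔ 4050) — Type-I Liouville on `𝒦_C` and on the rate class `A_C` are the same statement.
[cite: KochNadirashviliSereginSverak2009, §1 and §6] -/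
theorem squeezeLiouville_iff_typeIAncientLiouville : Summit.NavierStokesRegularity.NavierStokesRegularity.Theses.SqueezeCycle.SqueezeLiouville ↔ Summit.NavierStokesRegularity.NavierStokesRegularity.Theses.SymmetryModuliCount.TypeIAncientLiouville :=
  ⟨typeIAncientLiouville_of_squeezeLiouville, squeezeLiouville_of_typeIAncientLiouville⟩

/-- **Crux ↔ SymmetryModuliCount's target**: `ExtremalBiaxialitySubcritical ↔ TypeIAncientLiouville`
(items 11609 ↔ 4050). [cite: KochNadirashviliSereginSverak2009, §1 and §6] -/
theorem extremalBiaxialitySubcritical_iff_typeIAncientLiouville : Summit.NavierStokesRegularity.NavierStokesRegularity.Theses.SqueezeCycle.ExtremalBiaxialitySubcritical ↔ Summit.NavierStokesRegularity.NavierStokesRegularity.Theses.SymmetryModuliCount.TypeIAncientLiouville :=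
  extremalBiaxialitySubcritical_iff_squeezeLiouville.trans squeezeLiouville_iff_typeIAncientLiouville

/-- `TypeIAncientLiouville ↔ RecurrentLiouville` (items 4050 ↔ 1589).
[cite: AlbrittonBarker2019, Thm 1.1, §3] -/
theorem typeIAncientLiouville_iff_recurrentLiouville :
    SymmetryModuliCount.TypeIAncientLiouville ↔ SqueezeCycle.RecurrentLiouville :=
  squeezeLiouville_iff_typeIAncientLiouville.symm.trans squeezeLiouville_iff_recurrentLiouville

/-- `TypeIAncientLiouville ↔ NoTypeIRateProfile` (items 4050 ↔ 1588): Liouville on the smooth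
KNSS-mild rate class and "no Type-I-rate singular profile in the Albritton–Barker local-energy class"
are the same statement. [cite: AlbrittonBarker2019, Thm 1.1, §3] -/
theorem typeIAncientLiouville_iff_noTypeIRateProfile :
    SymmetryModuliCount.TypeIAncientLiouville ↔ RecurrentProfiles.NoTypeIRateProfile :=
  squeezeLiouville_iff_typeIAncientLiouville.symm.trans squeezeLiouville_iff_noTypeIRateProfile

/-- `TypeIAncientLiouville ↔ (NoApexTypeIProfile ∧ ApexLocalisation)` (items 4050 ↔ 11716 ∧ 11719).
[cite: AlbrittonBarker2019, Thm 1.1, §3] [cite: KNSS2009, (1.6)] -/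
theorem typeIAncientLiouville_iff_rellichScar :
    SymmetryModuliCount.TypeIAncientLiouville ↔
      (RellichScar.NoApexTypeIProfile ∧ RellichScar.ApexLocalisation) :=
  typeIAncientLiouville_iff_recurrentLiouville.trans recurrentLiouville_iff_rellichScar

/-! ### ClockStretchingLaw's target: no singular Type-I model -/

/-- **`NoSingularTypeIModel → SqueezeLiouville`** (items 10569 → 11608).  If a member `u` of `𝒦_C`
does not vanish on `t < 0`, item 15368 (`squeezeCycle_singularProfileOfNontrivial_proof`, the
Albritton–Barker zoom-out) gives a suitable weak solution on the backward slab with `𝐈 < ⊤`, the rate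
`C` and a backward-singular origin; its continuous Oseen-mild representative `v` is a Type-I ancient
mild field (`exists_oseenMild_repr_of_typeIBound_lt_top`, `isTypeIAncientMild_of_continuous_oseenMild`),
hence a member of `𝒦_{C'}` (`squeezeClass_of_isTypeIAncientMild`), and it is still backward-singular at
the origin (`IsBackwardSingularPoint.congr_ae`); a pointwise bound on a backward cylinder at the origin
would bound its `L^∞` norm there. So `v` is a singular Type-I model, contradicting the hypothesis.
[cite: AlbrittonBarker2019, Thm 1.1, §3] [cite: KochNadirashviliSereginSverak2009, Lemma 3.1, Prop. 4.1] -/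
theorem squeezeLiouville_of_noSingularTypeIModel (h : ClockStretchingLaw.NoSingularTypeIModel) :
    SqueezeCycle.SqueezeLiouville := by
  intro C u hu t ht x
  by_contra hne
  -- a nontrivial member has a Type-I-rate singular profile (item 15368)
  obtain ⟨w, q, H, hsw, hwg, hI, hdec, hsing⟩ :=
    squeezeCycle_singularProfileOfNontrivial_proof C u hu ⟨t, ht, x, hne⟩
  -- its continuous Oseen-mild representative lies in `A_C ⊆ 𝒦_{C'}`
  obtain ⟨v, hae, hvc, hvd, hvm, hvC⟩ := exists_oseenMild_repr_of_typeIBound_lt_top hsw hdec hI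
  have hv : IsTypeIAncientMild C v := isTypeIAncientMild_of_continuous_oseenMild hvc hvd hvm hvC
  obtain ⟨C', -, hC'⟩ := squeezeClass_of_isTypeIAncientMild C
  -- and is backward-singular at the origin
  have hsingv : IsBackwardSingularPoint v 0 :=
    hsing.congr_ae (fun r _ => parabolicCylinder_origin_subset_slab r) hae
  -- the hypothesis bounds `v` pointwise on some backward cylinder at the origin: contradiction
  refine h C' v (hC' v hv) fun r hr M => ?_
  by_contra hcon
  push Not at hcon
  have hbd : ∀ᵐ z ∂(volume.restrict (parabolicCylinder r (0 : ℝ × EuclideanSpace ℝ (Fin 3)))),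
      ‖uncurry v z‖ ≤ M := by
    filter_upwards [ae_restrict_mem (isOpen_parabolicCylinder r _).measurableSet] with z hz
    rw [mem_parabolicCylinder] at hz
    simp only [Prod.fst_zero, Prod.snd_zero, zero_sub] at hz
    exact hcon z.1 ⟨hz.1.1, hz.1.2⟩ z.2 (by simpa [mem_ball] using hz.2)
  have hle : eLpNorm (uncurry v) ⊤ (volume.restrict (parabolicCylinder r (0 : ℝ × EuclideanSpace ℝ (Fin 3)))) ≤
      ENNReal.ofReal M := by
    rw [eLpNorm_exponent_top]
    exact eLpNormEssSup_le_of_ae_bound hbd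
  have htop := hsingv r hr
  rw [htop] at hle
  exact lt_irrefl _ (hle.trans_lt ENNReal.ofReal_lt_top)

/-- **Target ↔ ClockStretchingLaw's target**: `SqueezeLiouville ↔ NoSingularTypeIModel` (items 11608 ↔ 10569).
[cite: AlbrittonBarker2019, Thm 1.1, §3] -/
theorem squeezeLiouville_iff_noSingularTypeIModel : Summit.NavierStokesRegularity.NavierStokesRegularity.Theses.SqueezeCycle.SqueezeLiouville ↔ Summit.NavierStokesRegularity.NavierStokesRegularity.Theses.ClockStretchingLaw.NoSingularTypeIModel :=
  ⟨TubeAlternative.noSingularTypeIModel_of_squeezeLiouville, squeezeLiouville_of_noSingularTypeIModel⟩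

/-- **Crux ↔ ClockStretchingLaw's target**: `ExtremalBiaxialitySubcritical ↔ NoSingularTypeIModel`
(items 11609 ↔ 10569). [cite: AlbrittonBarker2019, Thm 1.1, §3] -/
theorem extremalBiaxialitySubcritical_iff_noSingularTypeIModel : Summit.NavierStokesRegularity.NavierStokesRegularity.Theses.SqueezeCycle.ExtremalBiaxialitySubcritical ↔ Summit.NavierStokesRegularity.NavierStokesRegularity.Theses.ClockStretchingLaw.NoSingularTypeIModel :=
  extremalBiaxialitySubcritical_iff_squeezeLiouville.trans squeezeLiouville_iff_noSingularTypeIModel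

/-! ### The same node in the other routes' spellings -/

/-- Crux ↔ `ExtremalTypeIConstant.TypeIAncientLiouville` (route ExtremalTypeIConstant's copy of item 4050;
the two route copies agree letter for letter). [cite: KochNadirashviliSereginSverak2009, §1 and §6] -/
theorem extremalBiaxialitySubcritical_iff_extremalTypeIConstant_typeIAncientLiouville :
    SqueezeCycle.ExtremalBiaxialitySubcritical ↔ ExtremalTypeIConstant.TypeIAncientLiouville :=
  extremalBiaxialitySubcritical_iff_typeIAncientLiouville.trans Iff.rfl

/-- Crux ↔ `DulacContraction.NoTypeIRateProfile` (route DulacContraction's copy of item 1588; the two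
route copies agree letter for letter). [cite: AlbrittonBarker2019, Thm 1.1, §3] -/
theorem extremalBiaxialitySubcritical_iff_dulacContraction_noTypeIRateProfile :
    SqueezeCycle.ExtremalBiaxialitySubcritical ↔ DulacContraction.NoTypeIRateProfile :=
  extremalBiaxialitySubcritical_iff_noTypeIRateProfile.trans Iff.rfl

/-- **Crux ↔ the route's own two open children** (SqueezeCycle spellings of items 11716 ∧ 11719):
`ExtremalBiaxialitySubcritical ↔ (NoApexTypeIProfile ∧ ApexLocalisation)`. [cite: KNSS2009, (1.6)] -/
theorem extremalBiaxialitySubcritical_iff_noApexTypeIProfile_and_apexLocalisation :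
    SqueezeCycle.ExtremalBiaxialitySubcritical ↔
      (SqueezeCycle.NoApexTypeIProfile ∧ SqueezeCycle.ApexLocalisation) :=
  extremalBiaxialitySubcritical_iff_rellichScar.trans
    (and_congr NoApexKNSS.noApexTypeIProfile_iff_rellichScar
      NoApexKNSS.apexLocalisation_iff_rellichScar).symm

end Summit.NavierStokesRegularity.NavierStokesRegularity.Theorems

end
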